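import Summits.Schanuel.Schanuel.Theorems.RootDecomp1GradedConeTransfer

/-!
# RootDecomp1GradedConeLadder — part 4/5 of the port of lens-1 gen 13 «GRADED CONE» (route RootDecomp1 rev 22; THEOREM ROUND, critic VERDICT 2026-08-30T16:07:00Z ACCEPTED, (iii)-partial grade transfer = STRUCTURE currency; port optional-LOW (b))

§6: THE B-LADDER Sₙ ⟹ Bₙ₊₁ (B load-bearing only from length 4) and downward monotonicity of the rows S and B (pad by an algebraic number outside the ℚ-span; explicit FaithfulSMul instance kept — documented timeout).

Port (census-1 gen 8) of HOME/decomp-schanuel-lens-1/g13/GradedCone.lean (sha256 abae003f…, 1137 l, 74 theorems; rc 0 against rev 22). Hygiene per the critic: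
h1 the graded `def … : Prop` are GRADINGS of the rows S / B / U⊥ / U♮ / Cⁿᵘ (cell definitions of this file, not route items and not cited facts);
h2 explicit `FaithfulSMul` instance kept; h3 the §8 `example` block stays; h4 `ladderCollapseGlue_of_graded` is a plain theorem (26483 closed by p778320);
h5 advisory lint.theses-cone expected (imports Theses.RootDecomp1). Namespace `Summit.Schanuel.Schanuel.Theorems.RootDecomp1GradedCone`; statements and proofs verbatim.
`--supports stmt-Schanuel-25020`. Sorry-free; standard axioms. Nothing here proves Schanuel; rung 0.
-/

noncomputable section

set_option linter.dupNamespace false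

namespace Summit.Schanuel.Schanuel.Theorems.RootDecomp1GradedCone

open Complex IntermediateField
open scoped BigOperators
open Summit.Schanuel.Schanuel.Theses.RootDecomp1 (SchanuelTwo EssentialCounterexamplesInEcl
  DefectOneSchanuel LinearSchanuel QuadraticSchanuel RationalImageSchanuel LadderCollapseGlue
  NonrationalSaturatedEssentialSchanuel closes)
open Summit.Schanuel.Schanuel.Theorems.RootDecomp1EssentialInEcl (essentialCounterexamplesInEcl_holds)
open Literature.NumberTheory.Transcendental (transcendental_exp_holds)
open Literature.NumberTheory.Transcendental.OneMotiveToric (trdeg_mono)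
open Literature.NumberTheory.Transcendental.Philippon1986_criterion (trdeg_adjoin_range_le)
open Literature.Barriers.Schanuel (algebraicIndependent_of_le_trdeg_adjoin
  trdeg_adjoin_union_eq_of_isAlgebraic)
open Summit.Schanuel.Schanuel.Theorems.RootDecomp1LadderCollapse (Qbar quad aeval_mem_adjoin exists_nat_trdeg_range
  algCoeff_map eval_map_Qbar aeval_quad totalDegree_quad_le gadget_rigid)
open Literature.RingTheory.MvPolynomial.Ruppert (totalDegree_pow_of_ne_zero)


/-! ## 6. THE B-LADDER: `Sₙ ⟹ Bₙ₊₁`; B is load-bearing only from length 4 on -/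

/-- **`Sₙ ⟹ Bₙ₊₁`** (drop the last coordinate: trdeg is monotone in the tuple). -/
theorem defectOneAt_succ_of_schanuelAt {n : ℕ} (h : SchanuelAt n) : DefectOneAt (n + 1) := by
  intro x hx
  set z : Fin n → ℂ := fun i => x (Fin.castSucc i) with hz
  have hzli : LinearIndependent ℚ z := hx.comp Fin.castSucc (Fin.castSucc_injective n)
  have h1 := h z hzli
  have hsub : Set.range z ∪ Set.range (cexp ∘ z) ⊆ Set.range x ∪ Set.range (cexp ∘ x) := by
    rintro y (⟨i, rfl⟩ | ⟨i, rfl⟩)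
    · exact Or.inl ⟨Fin.castSucc i, rfl⟩
    · exact Or.inr ⟨Fin.castSucc i, rfl⟩
  have h2 : Algebra.trdeg ℚ ↥(adjoin ℚ (Set.range z ∪ Set.range (cexp ∘ z))) ≤
      Algebra.trdeg ℚ ↥(adjoin ℚ (Set.range x ∪ Set.range (cexp ∘ x))) :=
    trdeg_mono (adjoin.mono ℚ _ _ hsub)
  calc ((n + 1 : ℕ) : Cardinal) = (n : Cardinal) + 1 := Nat.cast_succ n
    _ ≤ Algebra.trdeg ℚ ↥(adjoin ℚ (Set.range x ∪ Set.range (cexp ∘ x))) + 1 :=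
        add_le_add (h1.trans h2) le_rfl

/-- `SchanuelAt 0`. -/
theorem schanuelAt_zero : SchanuelAt 0 := fun z _ => by simp

/-- `S₁` (Hermite–Lindemann, tree theorem). -/
theorem schanuelAt_one : SchanuelAt 1 :=
  Literature.Transcend.schanuelRank_one_of_transcendental_exp transcendental_exp_holds

/-- **`B₀, B₁, B₂` are theorems and `S₂ ⟹ B₃`.** -/
theorem defectOneAt_of_le_three (h₂ : SchanuelTwo) {n : ℕ} (hn : n ≤ 3) : DefectOneAt n := by
  rcases (by omega : n = 0 ∨ n = 1 ∨ n = 2 ∨ n = 3) with rfl | rfl | rfl | rfl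
  · intro z _; simp
  · exact defectOneAt_succ_of_schanuelAt schanuelAt_zero
  · exact defectOneAt_succ_of_schanuelAt schanuelAt_one
  · exact defectOneAt_succ_of_schanuelAt (schanuelAt_two_iff.mpr h₂)

/-- `B₂` unconditionally (from S₁). -/
theorem defectOneAt_two : DefectOneAt 2 := defectOneAt_succ_of_schanuelAt schanuelAt_one

/-- **The row B is load-bearing only from length 4 on:** `S₂ ∧ ⋀_{n ≥ 4} Bₙ ⟹ B`. -/
theorem defectOneSchanuel_of_geFour (h₂ : SchanuelTwo) (hB : ∀ n, 4 ≤ n → DefectOneAt n) :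
    DefectOneSchanuel :=
  fun n => if hn : n ≤ 3 then defectOneAt_of_le_three h₂ hn else hB n (by omega)

/-! ### Downward monotonicity of the rows S and B (pad by an algebraic number outside the ℚ-span) -/

/-- ℚ̄ is not contained in any finitely generated ℚ-subspace of ℂ: for every `z : Fin n → ℂ` some
algebraic number lies outside `span_ℚ (range z)` — one of the powers `ζ^i`, `i < p − 1`, of a primitive
`p`-th root of unity `ζ`, `p` a prime `≥ n + 2` (they are ℚ-l.i.: `cyclotomic p ℚ` is the minimal
polynomial). -/
theorem exists_algebraic_not_mem_span {n : ℕ} (z : Fin n → ℂ) :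
    ∃ β : ℂ, IsAlgebraic ℚ β ∧ β ∉ Submodule.span ℚ (Set.range z) := by
  classical
  obtain ⟨p, hpn, hp⟩ := Nat.exists_infinite_primes (n + 2)
  set ζ : ℂ := cexp (2 * Real.pi * I / p) with hζ
  have hprim : IsPrimitiveRoot ζ p := Complex.isPrimitiveRoot_exp p hp.ne_zero
  have hint : IsIntegral ℚ ζ := (hprim.isIntegral hp.pos).tower_top
  have hdeg : (minpoly ℚ ζ).natDegree = p - 1 := by
    rw [← Polynomial.cyclotomic_eq_minpoly_rat hprim hp.pos, Polynomial.natDegree_cyclotomic,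
      Nat.totient_prime hp]
  have hli := linearIndependent_pow (K := ℚ) ζ
  by_contra hall
  push Not at hall
  have hmem : ∀ i : Fin (minpoly ℚ ζ).natDegree, ζ ^ (i : ℕ) ∈ Submodule.span ℚ (Set.range z) :=
    fun i => hall _ (hint.pow _).isAlgebraic
  haveI : Module.Finite ℚ ↥(Submodule.span ℚ (Set.range z)) :=
    Module.Finite.span_of_finite ℚ (Set.finite_range z)
  have hli' : LinearIndependent ℚ (fun i : Fin (minpoly ℚ ζ).natDegree =>
      (⟨ζ ^ (i : ℕ), hmem i⟩ : ↥(Submodule.span ℚ (Set.range z)))) :=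
    LinearIndependent.of_comp (Submodule.span ℚ (Set.range z)).subtype (by exact hli)
  have h1 := hli'.fintype_card_le_finrank
  rw [Fintype.card_fin, hdeg] at h1
  have h2 : Module.finrank ℚ ↥(Submodule.span ℚ (Set.range z)) ≤ n := by
    have := finrank_range_le_card (R := ℚ) z
    simpa [Set.finrank] using this
  omega

/-- Adjoining ONE element to an intermediate field raises the transcendence degree by at most one. -/
theorem trdeg_adjoin_field_insert_le (K : IntermediateField ℚ ℂ) (w : ℂ) :
    Algebra.trdeg ℚ ↥(adjoin ℚ ((K : Set ℂ) ∪ {w})) ≤ Algebra.trdeg ℚ ↥K + 1 := by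
  -- (the instance is found by search in the route file's smaller environment; here we give it by hand)
  haveI : FaithfulSMul (↥K) ↥(IntermediateField.adjoin (↥K) ({w} : Set ℂ)) :=
    (faithfulSMul_iff_algebraMap_injective (↥K) ↥(IntermediateField.adjoin (↥K) ({w} : Set ℂ))).mpr
      (algebraMap (↥K) ↥(IntermediateField.adjoin (↥K) ({w} : Set ℂ))).injective
  have h := trdeg_add_eq ℚ (↥K) (A := ↥(IntermediateField.adjoin (↥K) ({w} : Set ℂ)))
  have h1 : Algebra.trdeg (↥K) ↥(IntermediateField.adjoin (↥K) ({w} : Set ℂ)) ≤ 1 := by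
    have := trdeg_adjoin_range_le (F := ↥K) (E := ℂ) (fun _ : Fin 1 => w)
    rwa [Set.range_const, Nat.cast_one] at this
  have e := (IntermediateField.equivOfEq
    (IntermediateField.restrictScalars_adjoin ℚ K ({w} : Set ℂ))).symm.trdeg_eq
  calc Algebra.trdeg ℚ ↥(adjoin ℚ ((K : Set ℂ) ∪ {w}))
      = Algebra.trdeg ℚ ↥((IntermediateField.adjoin (↥K) ({w} : Set ℂ)).restrictScalars ℚ) := e
    _ = Algebra.trdeg ℚ ↥(IntermediateField.adjoin (↥K) ({w} : Set ℂ)) := rfl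
    _ = Algebra.trdeg ℚ ↥K + Algebra.trdeg (↥K) ↥(IntermediateField.adjoin (↥K) ({w} : Set ℂ)) :=
        h.symm
    _ ≤ Algebra.trdeg ℚ ↥K + 1 := add_le_add le_rfl h1

/-- Adjoining ONE element raises the transcendence degree over ℚ by at most one. -/
theorem trdeg_adjoin_insert_le (S : Set ℂ) (w : ℂ) :
    Algebra.trdeg ℚ ↥(adjoin ℚ (S ∪ {w})) ≤ Algebra.trdeg ℚ ↥(adjoin ℚ S) + 1 := by
  have hKS : (S ∪ {w} : Set ℂ) ⊆ ((adjoin ℚ S : IntermediateField ℚ ℂ) : Set ℂ) ∪ {w} :=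
    Set.union_subset_union_left _ (subset_adjoin ℚ S)
  exact (trdeg_mono (adjoin.mono ℚ _ _ hKS)).trans (trdeg_adjoin_field_insert_le _ w)

/-- Prepending an ALGEBRAIC number `β` to `z` raises `trdeg ℚ(z, e^z)` by at most one (only `e^β` counts). -/
theorem trdeg_cons_algebraic_le {n : ℕ} (z : Fin n → ℂ) (β : ℂ) (hβ : IsAlgebraic ℚ β) :
    Algebra.trdeg ℚ ↥(adjoin ℚ (Set.range (Fin.cons β z : Fin (n + 1) → ℂ) ∪
        Set.range (cexp ∘ (Fin.cons β z : Fin (n + 1) → ℂ)))) ≤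
      Algebra.trdeg ℚ ↥(adjoin ℚ (Set.range z ∪ Set.range (cexp ∘ z))) + 1 := by
  set S : Set ℂ := Set.range z ∪ Set.range (cexp ∘ z) with hS
  have hsub : Set.range (Fin.cons β z : Fin (n + 1) → ℂ) ∪
      Set.range (cexp ∘ (Fin.cons β z : Fin (n + 1) → ℂ)) ⊆ (S ∪ {cexp β}) ∪ {β} := by
    rintro x (⟨i, rfl⟩ | ⟨i, rfl⟩)
    · refine Fin.cases ?_ (fun j => ?_) i
      · exact Or.inr (by simp)
      · exact Or.inl (Or.inl (Or.inl ⟨j, by simp⟩))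
    · refine Fin.cases ?_ (fun j => ?_) i
      · exact Or.inl (Or.inr (by simp))
      · exact Or.inl (Or.inl (Or.inr ⟨j, by simp⟩))
  have h2 := trdeg_mono (adjoin.mono ℚ _ _ hsub)
  have h3 : Algebra.trdeg ℚ ↥(adjoin ℚ ((S ∪ {cexp β}) ∪ {β})) =
      Algebra.trdeg ℚ ↥(adjoin ℚ (S ∪ {cexp β})) :=
    trdeg_adjoin_union_eq_of_isAlgebraic (K := ℚ) (S ∪ {cexp β}) {β}
      (fun x hx => by rw [Set.mem_singleton_iff.mp hx]; exact hβ)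
  exact h2.trans (h3.le.trans (trdeg_adjoin_insert_le S (cexp β)))

/-- **Downward monotonicity of S:** `Sₙ₊₁ ⟹ Sₙ`. -/
theorem schanuelAt_of_succ {n : ℕ} (h : SchanuelAt (n + 1)) : SchanuelAt n := by
  intro z hz
  obtain ⟨β, hβ, hβs⟩ := exists_algebraic_not_mem_span z
  have hli : LinearIndependent ℚ (Fin.cons β z : Fin (n + 1) → ℂ) :=
    linearIndependent_finCons.mpr ⟨hz, hβs⟩
  have h1 := (h (Fin.cons β z) hli).trans (trdeg_cons_algebraic_le z β hβ)
  have h4 : ((n + 1 : ℕ) : Cardinal) = (n : Cardinal) + 1 := by push_cast; rfl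
  rw [h4] at h1
  exact (Cardinal.add_le_add_iff_of_lt_aleph0 Cardinal.one_lt_aleph0).mp h1

/-- **Downward monotonicity of B:** `Bₙ₊₁ ⟹ Bₙ`. -/
theorem defectOneAt_of_succ {n : ℕ} (h : DefectOneAt (n + 1)) : DefectOneAt n := by
  intro z hz
  obtain ⟨β, hβ, hβs⟩ := exists_algebraic_not_mem_span z
  have hli : LinearIndependent ℚ (Fin.cons β z : Fin (n + 1) → ℂ) :=
    linearIndependent_finCons.mpr ⟨hz, hβs⟩
  have h1 := (h (Fin.cons β z) hli).trans (add_le_add (trdeg_cons_algebraic_le z β hβ) (le_refl 1))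
  have h4 : ((n + 1 : ℕ) : Cardinal) = (n : Cardinal) + 1 := by push_cast; rfl
  rw [h4] at h1
  exact (Cardinal.add_le_add_iff_of_lt_aleph0 Cardinal.one_lt_aleph0).mp h1

/-- `SchanuelAt n`. -/
theorem schanuelAt_of_le {n m : ℕ} (hnm : n ≤ m) (h : SchanuelAt m) : SchanuelAt n := by
  obtain ⟨j, rfl⟩ : ∃ j, m = n + j := ⟨m - n, by omega⟩
  induction j with
  | zero => exact h
  | succ j ih => exact ih (by omega) (schanuelAt_of_succ h)

/-- `DefectOneAt n`. -/
theorem defectOneAt_of_le {n m : ℕ} (hnm : n ≤ m) (h : DefectOneAt m) : DefectOneAt n := by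
  obtain ⟨j, rfl⟩ : ∃ j, m = n + j := ⟨m - n, by omega⟩
  induction j with
  | zero => exact h
  | succ j ih => exact ih (by omega) (defectOneAt_of_succ h)

/-- **No single grade of B is load-bearing either:** B ⟸ any cofinal family of its grades. -/
theorem defectOneSchanuel_of_cofinal (hB : ∀ N : ℕ, ∃ m, N ≤ m ∧ DefectOneAt m) :
    DefectOneSchanuel := fun n => by
  obtain ⟨m, hm, hBm⟩ := hB n
  exact defectOneAt_of_le hm hBm

/-- Schanuel ⟸ any cofinal family of its own grades (a counterexample propagates to all larger lengths). -/
theorem schanuel_of_cofinal (h : ∀ N : ℕ, ∃ m, N ≤ m ∧ SchanuelAt m) : _root_.Schanuel := fun n => by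
  obtain ⟨m, hm, hSm⟩ := h n
  exact schanuelAt_of_le hm hSm

end Summit.Schanuel.Schanuel.Theorems.RootDecomp1GradedCone
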